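import Summits.Ventures.WeilGRH.DirichletCharacterCensus20
import Literature.NumberTheory.LFunctions.WeilExplicitDirichlet
import Mathlib.RingTheory.RootsOfUnity.Complex
import Mathlib.NumberTheory.DirichletCharacter.Basic
import HarnessLib

/-!
# Bridge: a checked census row IS a primitive Dirichlet character (values, parity, primitivity)

For a row `R : ConreyRow` of the census (`DirichletCharacterCensus20.lean`) passing `R.check = true`
we construct the Dirichlet character `R.toChar h : DirichletCharacter ℂ R.q` whose values are the
tabulated roots of unity, `χ(k) = ζ^{E[k]}` (`ζ = exp(2πi/ord)`) for `gcd(k, q) = 1` and `0` otherwise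
(`toChar_apply_natCast`), and prove from the Boolean checks alone that
* its parity is the tabulated one: `charParity (R.toChar h) = R.par` (`charParity_toChar`), i.e.
  `χ(−1) = (−1)^{par}`;
* it is PRIMITIVE: `(R.toChar h).IsPrimitive` (`isPrimitive_toChar`) — via Mathlib's
  `DirichletCharacter.factorsThrough_iff_ker_unitsMap`: for each proper divisor `d ∣ q` the table
  exhibits a unit `k ≡ 1 (mod d)` with `χ(k) = ζ^{E[k]} ≠ 1` (`0 < E[k] < ord`, `ζ` primitive).
So every `(q, χ, t)` rung of the GRH arm can name its character as a TERM,
`(census20[i]).toChar (census20_check i)`, with kernel-computable values for the prime side of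
`weilQuadraticChar` and the right archimedean kernel `Re ψ(1/4 + par/2 + it/2)`.
-/

noncomputable section

open Complex
open scoped Real

namespace Summit.Ventures.WeilGRH

namespace ConreyRow

variable (R : ConreyRow)

/-! ## Unpacking the Boolean checks -/

/-- Membership in `R.units`: `k < q` and `gcd(k, q) = 1`. [folklore] -/
theorem mem_units {k : ℕ} : k ∈ R.units ↔ k < R.q ∧ Nat.Coprime k R.q := by
  simp [units, List.mem_filter]

variable {R}

/-- What `checkShape` says. [folklore] -/
theorem of_checkShape (h : R.checkShape = true) :
    R.expo.length = R.q ∧ 3 ≤ R.q ∧ 1 ≤ R.ord ∧ R.e 1 = 0 ∧ Nat.Coprime R.n R.q ∧ R.n < R.q ∧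
      ∀ k ∈ R.units, R.e k < R.ord := by
  simpa [checkShape, Bool.and_eq_true, List.all_eq_true, Nat.ble_eq, and_assoc] using h

/-- What `checkHom` says: `E[jk] ≡ E[j] + E[k] (mod ord)` on units. [folklore] -/
theorem of_checkHom (h : R.checkHom = true) {j k : ℕ} (hj : j ∈ R.units) (hk : k ∈ R.units) :
    R.e (j * k) % R.ord = (R.e j + R.e k) % R.ord := by
  simp only [checkHom, List.all_eq_true, beq_iff_eq] at h
  exact h j hj k hk

/-- What `checkParity` says. [folklore] -/
theorem of_checkParity (h : R.checkParity = true) :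
    (R.par = 0 ∧ R.e (R.q - 1) = 0) ∨ (R.par = 1 ∧ 2 * R.e (R.q - 1) = R.ord) := by
  simpa [checkParity, Bool.and_eq_true, Bool.or_eq_true] using h

/-- What `checkPrimitive` says: every proper divisor `d` of `q` has a unit `k ≡ 1 (mod d)` with
`E[k] ≠ 0`. [folklore] -/
theorem of_checkPrimitive (h : R.checkPrimitive = true) {d : ℕ} (hd1 : 1 ≤ d) (hdq : d < R.q)
    (hdvd : d ∣ R.q) : ∃ k ∈ R.units, k % d = 1 % d ∧ R.e k ≠ 0 := by
  simp only [checkPrimitive, List.all_eq_true, List.mem_filter, List.mem_range, List.any_eq_true,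
    Bool.and_eq_true, beq_iff_eq, bne_iff_ne, ne_eq, decide_eq_true_eq, and_imp] at h
  obtain ⟨k, hk, hk1, hk0⟩ := h d hdq hd1 (Nat.mod_eq_zero_of_dvd hdvd)
  exact ⟨k, hk, hk1, hk0⟩

/-- The five checks from `check`. [folklore] -/
theorem of_check (h : R.check = true) :
    R.checkShape = true ∧ R.checkHom = true ∧ R.checkOrder = true ∧ R.checkParity = true ∧
      R.checkPrimitive = true := by
  simpa [check, Bool.and_eq_true, and_assoc] using h

/-- `R.e` only depends on `k mod q`. [folklore] -/
theorem e_mod (k : ℕ) : R.e (k % R.q) = R.e k := by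
  simp [e]

/-- A checked row has `q ≠ 0` (indeed `q ≥ 3`), so `ZMod q` is a finite ring; use as
`haveI := ConreyRow.neZero_of_check h`. [folklore] -/
theorem neZero_of_check (h : R.check = true) : NeZero R.q :=
  ⟨by have := (of_checkShape (of_check h).1).2.1; omega⟩

/-! ## The root of unity and the unit homomorphism -/

variable (R)

/-- `ζ = exp(2πi/ord)`, a primitive `ord`-th root of unity. [folklore] -/
def zeta : ℂ := Complex.exp (2 * π * I / R.ord)

variable {R}

/-- `ζ` is a primitive `ord`-th root of unity (needs `ord ≠ 0`, part of `checkShape`). [folklore] -/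
theorem isPrimitiveRoot_zeta (h : R.checkShape = true) : IsPrimitiveRoot R.zeta R.ord :=
  Complex.isPrimitiveRoot_exp R.ord (by have := (of_checkShape h).2.2.1; omega)

/-- `ζ ^ ord = 1`. [folklore] -/
theorem zeta_pow_ord (h : R.checkShape = true) : R.zeta ^ R.ord = 1 :=
  (isPrimitiveRoot_zeta h).pow_eq_one

variable (R)

/-- `ζ` as a unit of `ℂ` (it is non-zero, being an exponential). [folklore] -/
def zetaUnit : ℂˣ := Units.mk0 R.zeta (Complex.exp_ne_zero _)

/-- The would-be unit homomorphism `u ↦ ζ^{E[u]}` on `(ℤ/q)ˣ` (a bare function; it is a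
homomorphism when `R.check = true`, `unitHom`). [folklore] -/
def unitFun (u : (ZMod R.q)ˣ) : ℂˣ := R.zetaUnit ^ R.e (u : ZMod R.q).val

variable {R}

/-- A unit of `ZMod q` gives an element of `R.units`. [folklore] -/
theorem val_mem_units [NeZero R.q] (u : (ZMod R.q)ˣ) : (u : ZMod R.q).val ∈ R.units :=
  R.mem_units.2 ⟨ZMod.val_lt _, ZMod.val_coe_unit_coprime u⟩

/-- Under `check`, `unitFun` is multiplicative. [folklore] -/
theorem unitFun_mul (h : R.check = true) [NeZero R.q] (u v : (ZMod R.q)ˣ) :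
    R.unitFun (u * v) = R.unitFun u * R.unitFun v := by
  obtain ⟨hS, hH, -, -, -⟩ := of_check h
  have hpow : R.zetaUnit ^ R.ord = 1 := by
    ext; simp [zetaUnit, zeta_pow_ord hS]
  have hmod := of_checkHom hH (val_mem_units u) (val_mem_units v)
  rw [unitFun, unitFun, unitFun, ← pow_add, Units.val_mul, ZMod.val_mul, e_mod,
    pow_eq_pow_mod _ hpow, hmod, ← pow_eq_pow_mod _ hpow]

/-- Under `check`, `unitFun 1 = 1` (`E[1] = 0`). [folklore] -/
theorem unitFun_one (h : R.check = true) [NeZero R.q] : R.unitFun 1 = 1 := by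
  obtain ⟨hS, -, -, -, -⟩ := of_check h
  have h3 := (of_checkShape hS).2.1
  haveI : Fact (1 < R.q) := ⟨by omega⟩
  rw [unitFun, Units.val_one, ZMod.val_one, (of_checkShape hS).2.2.2.1, pow_zero]

variable (R)

/-- The unit homomorphism `(ℤ/q)ˣ →* ℂˣ`, `u ↦ ζ^{E[u]}`, of a checked row. [folklore] -/
def unitHom (h : R.check = true) [NeZero R.q] : (ZMod R.q)ˣ →* ℂˣ where
  toFun := R.unitFun
  map_one' := unitFun_one h
  map_mul' := unitFun_mul h

/-- **The Dirichlet character of a checked census row.** [folklore] -/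
def toChar (h : R.check = true) [NeZero R.q] : DirichletCharacter ℂ R.q :=
  MulChar.ofUnitHom (R.unitHom h)

/-! ## Values -/

variable {R}

/-- Value at a unit: `χ(u) = ζ^{E[u]}`. [folklore] -/
theorem toChar_apply_unit (h : R.check = true) [NeZero R.q] (u : (ZMod R.q)ˣ) :
    R.toChar h (u : ZMod R.q) = R.zeta ^ R.e (u : ZMod R.q).val := by
  rw [toChar, MulChar.ofUnitHom_coe]
  simp [unitHom, unitFun, zetaUnit]

/-- **Values on naturals**: `χ(k) = ζ^{E[k]}` if `gcd(k, q) = 1`, and `χ(k) = 0` otherwise. [folklore] -/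
theorem toChar_apply_natCast (h : R.check = true) [NeZero R.q] (k : ℕ) :
    R.toChar h (k : ZMod R.q) = if Nat.Coprime k R.q then R.zeta ^ R.e k else 0 := by
  split_ifs with hk
  · rw [← ZMod.coe_unitOfCoprime k hk, toChar_apply_unit, ZMod.coe_unitOfCoprime, ZMod.val_natCast,
      e_mod]
  · exact MulChar.map_nonunit _ (by rwa [ZMod.isUnit_iff_coprime])

/-! ## Parity -/

/-- `χ(−1) = ζ^{E[q−1]}`. [folklore] -/
theorem toChar_neg_one (h : R.check = true) [NeZero R.q] :
    R.toChar h (-1) = R.zeta ^ R.e (R.q - 1) := by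
  obtain ⟨hS, -, -, -, -⟩ := of_check h
  have h3 := (of_checkShape hS).2.1
  have hcop : Nat.Coprime (R.q - 1) R.q := by
    have h' : Nat.Coprime (R.q - 1) (1 + (R.q - 1)) :=
      Nat.coprime_add_self_right.mpr (Nat.coprime_one_right _)
    rwa [show 1 + (R.q - 1) = R.q by omega] at h'
  have hneg : ((R.q - 1 : ℕ) : ZMod R.q) = -1 := by
    rw [Nat.cast_sub (by omega), ZMod.natCast_self, zero_sub, Nat.cast_one]
  rw [← hneg, toChar_apply_natCast, if_pos hcop]

/-- **Parity as tabulated**: `charParity (R.toChar h) = R.par`, i.e. the row's `par` selects the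
archimedean kernel `Re ψ(1/4 + par/2 + it/2)` of the base file. [folklore] -/
theorem charParity_toChar (h : R.check = true) [NeZero R.q] :
    Literature.NumberTheory.LFunctions.charParity (R.toChar h) = R.par := by
  obtain ⟨hS, -, -, hP, -⟩ := of_check h
  rcases of_checkParity hP with ⟨hp, he⟩ | ⟨hp, he⟩
  · rw [hp]
    exact Literature.NumberTheory.LFunctions.charParity_of_even
      (show R.toChar h (-1) = 1 by rw [toChar_neg_one, he, pow_zero])
  · rw [hp]
    refine Literature.NumberTheory.LFunctions.charParity_of_odd (show R.toChar h (-1) = -1 from ?_)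
    rw [toChar_neg_one]
    have hζ := isPrimitiveRoot_zeta hS
    set E := R.e (R.q - 1)
    have hsq : (R.zeta ^ E) ^ 2 = 1 := by rw [← pow_mul, mul_comm, he, hζ.pow_eq_one]
    have hne : R.zeta ^ E ≠ 1 := by
      intro h1
      have hdvd := (hζ.pow_eq_one_iff_dvd E).1 h1
      have hE : 0 < E := by
        have := (of_checkShape hS).2.2.1; omega
      have := Nat.le_of_dvd hE hdvd
      omega
    rcases sq_eq_one_iff.1 hsq with h1 | h1
    · exact absurd h1 hne
    · exact h1

/-! ## Primitivity -/

/-- **A checked row is primitive**: `conductor χ = q`. [folklore] -/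
theorem isPrimitive_toChar (h : R.check = true) [NeZero R.q] : (R.toChar h).IsPrimitive := by
  obtain ⟨hS, -, -, -, hPr⟩ := of_check h
  have hζ := isPrimitiveRoot_zeta hS
  -- no proper divisor carries the character
  have key : ∀ d : ℕ, d ∣ R.q → d < R.q → ¬ (R.toChar h).FactorsThrough d := by
    intro d hdvd hdq hF
    have hd1 : 1 ≤ d := Nat.pos_of_ne_zero fun hd ↦ by
      subst hd; exact (NeZero.ne R.q) (zero_dvd_iff.1 hdvd)
    obtain ⟨k, hk, hk1, hk0⟩ := of_checkPrimitive hPr hd1 hdq hdvd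
    obtain ⟨hkq, hkcop⟩ := R.mem_units.1 hk
    rw [DirichletCharacter.factorsThrough_iff_ker_unitsMap hdvd] at hF
    set u : (ZMod R.q)ˣ := ZMod.unitOfCoprime k hkcop with hu
    have hker : u ∈ (ZMod.unitsMap hdvd).ker := by
      rw [MonoidHom.mem_ker, Units.ext_iff, ZMod.unitsMap_val, Units.val_one, hu,
        ZMod.coe_unitOfCoprime, ZMod.cast_natCast hdvd, ← ZMod.natCast_mod k d, hk1,
        ZMod.natCast_mod, Nat.cast_one]
    have hχ := hF hker
    rw [MonoidHom.mem_ker, Units.ext_iff, MulChar.coe_toUnitHom, Units.val_one, hu,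
      ZMod.coe_unitOfCoprime, toChar_apply_natCast, if_pos hkcop] at hχ
    have hdvd' := (hζ.pow_eq_one_iff_dvd _).1 hχ
    have hlt : R.e k < R.ord := (of_checkShape hS).2.2.2.2.2.2 k hk
    have := Nat.le_of_dvd (Nat.pos_of_ne_zero hk0) hdvd'
    omega
  -- the conductor is a divisor through which χ factors, hence = q
  rw [DirichletCharacter.isPrimitive_def]
  by_contra hne
  have hdvd := DirichletCharacter.conductor_dvd_level (R.toChar h)
  have hlt : (R.toChar h).conductor < R.q :=
    lt_of_le_of_ne (Nat.le_of_dvd (Nat.pos_of_ne_zero (NeZero.ne _)) hdvd) hne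
  exact key _ hdvd hlt (DirichletCharacter.conductor_mem_conductorSet (R.toChar h))

end ConreyRow

/-! ## The census as characters -/

/-- Every row of `census20` passes `check` (pointwise form of `census20_wellFormed`). [folklore] -/
theorem census20_check (R : ConreyRow) (hR : R ∈ census20) : R.check = true :=
  List.all_eq_true.1 census20_wellFormed R hR

/-- **The census as primitive Dirichlet characters with the tabulated parity**: for every row `R` of
`census20`, `R.toChar` is a primitive character mod `R.q` whose parity exponent is `R.par`
(instance `NeZero R.q` from `ConreyRow.neZero_of_check`). [folklore] -/
theorem census20_toChar_spec (R : ConreyRow) (hR : R ∈ census20) [NeZero R.q] :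
    (R.toChar (census20_check R hR)).IsPrimitive ∧
      Literature.NumberTheory.LFunctions.charParity (R.toChar (census20_check R hR)) = R.par :=
  ⟨ConreyRow.isPrimitive_toChar _, ConreyRow.charParity_toChar _⟩

end Summit.Ventures.WeilGRH

end
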